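import Literature.Analysis.FluidPDE.JetStepWeightedEstimates
import Literature.Analysis.FluidPDE.BVEnergyStageTools
import HarnessLib

/-!
# The energy stage of Buckmaster–Vicol (Ann. of Math. 189 (2019), §7), II: the weighted jet
  step applied to the prepared base triple, with the energy bookkeeping

Analysis/FluidPDE support file (everything proved). `EnergyPump.jet_prep` applies
`JetStep.jet_step_weighted` to a base triple `(v_b, p_b, R_cb + s² N̊)` (as produced by
`EnergyPump.base_prep`) with the amplitude floor `γ₀ = r Δ / 3` (`r` the Nash radius, so that the
main energy term is `6γ₀/r = 2Δ`) and the weight normalised by `s² · 2Δ = ψ_δ(G_ℓ)²`, and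
repackages the two-sided energy identity of the step as
`|(e - ∫|v'|²) - ((e - ∫|v_b|²) - ψ_δ(G_ℓ)²)| ≤ ε_E`, i.e. the jets pump exactly the energy
`ψ_δ(G_ℓ)²` up to the error `ε_E` (BV 2019, (7.3)–(7.6)), together with the locality
`s(t) = 0 ⇒ v'(t) = v_b(t), R'(t) = R_cb(t)`.

## References

* T. Buckmaster, V. Vicol, Ann. of Math. 189 (2019) = arXiv:1709.10033, Prop. 2.1, §7. [`BuckmasterVicol2019Annals`]
* T. Buckmaster, V. Vicol, EMS Surv. Math. Sci. 6 (2019) = arXiv:1901.09023, Thm. 7.1, §7.7. [`BuckmasterVicol2020`]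
-/

noncomputable section

open MeasureTheory Set Filter Topology Function
open scoped InnerProductSpace ContDiff ENNReal NNReal

namespace Literature.Analysis.FluidPDE

namespace EnergyPump

open Literature.Analysis.FunctionSpaces FunctionSpaces.Torus NashGeometric JetStep


/-- The energy error of one weighted jet step: velocity cross terms, corrector energy, and the
improved-Hölder error of the principal jets (BV 2019, (7.4)–(7.6)). [cite: BuckmasterVicol2019Annals, §7] -/
def errE (c : StepConsts) (P : StepPars) : ℝ :=
  2 * P.V * (P.Lp c + P.Lc c + Real.sqrt (P.EX c) + Real.sqrt (P.Eζ c)) + (2 * (Real.sqrt (P.Ep c) * Real.sqrt (P.Er c)) + P.Er c) +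
    NN * (5 * (3 * P.H₁ c * (Real.sqrt 3 / P.σ)))

/-- Unfolding. [folklore] -/
theorem errE_def (c : StepConsts) (P : StepPars) : errE c P =
    2 * P.V * (P.Lp c + P.Lc c + Real.sqrt (P.EX c) + Real.sqrt (P.Eζ c)) + (2 * (Real.sqrt (P.Ep c) * Real.sqrt (P.Er c)) + P.Er c) +
      NN * (5 * (3 * P.H₁ c * (Real.sqrt 3 / P.σ))) := rfl

set_option maxHeartbeats 2000000 in
/-- **The weighted jet step on the prepared triple, with the energy bookkeeping** (see the module
docstring). [cite: BuckmasterVicol2019Annals, Prop. 2.1, §7; BuckmasterVicol2020, Thm. 7.1] -/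
theorem jet_prep : ∃ c : StepConsts, c.Valid ∧ c.Cp = 1 ∧
    ∀ (P : StepPars) (ν : ℝ) (e : ℝ → ℝ) (vb : ℝ → (UnitAddTorus (Fin 3)) → (EuclideanSpace ℝ (Fin 3))) (pb : ℝ → (UnitAddTorus (Fin 3)) → ℝ) (Rcb N : ℝ → (UnitAddTorus (Fin 3)) → Fin 3 → (EuclideanSpace ℝ (Fin 3))) (s Gm : ℝ → ℝ)
      (Δ δ ρc S' : ℝ),
    P.Valid → 0 < ν → ν ≤ 1 → P.γ₀ = radius (Fin 3) * Δ / 3 → 0 < δ →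
    Torus.IsNSReynoldsOn (Icc 0 P.T) ν vb pb (fun t y j => Rcb t y j + (s t) ^ 2 • Torus.traceless (N t) y j) →
    (∀ t ∈ Icc 0 P.T, HasZeroMean (vb t)) →
    FunctionSpaces.Torus.IsSmoothSpaceTimeOn (Icc 0 P.T) Rcb → (∀ t ∈ Icc 0 P.T, ∀ y, ∀ i j : Fin 3, Rcb t y i j = Rcb t y j i) →
    (∀ t ∈ Icc 0 P.T, ∀ y, ∑ i, Rcb t y i i = 0) →
    FunctionSpaces.Torus.IsSmoothSpaceTimeOn (Icc 0 P.T) N → (∀ t ∈ Icc 0 P.T, ∀ y, ∀ i j : Fin 3, N t y i j = N t y j i) →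
    ContDiffOn ℝ ∞ s (Icc 0 P.T) → (∀ t ∈ Icc 0 P.T, 0 ≤ s t ∧ s t ≤ 1) → (∀ t ∈ Icc 0 P.T, |derivWithin s (Icc 0 P.T) t| ≤ S') →
    (∀ t ∈ Icc 0 P.T, s t = 0 → derivWithin s (Icc 0 P.T) t = 0) →
    (∀ t, (s t) ^ 2 * (2 * Δ) = pumpProfile δ (Gm t) ^ 2) →
    (∀ t ∈ Icc 0 P.T, ∀ y, ‖vb t y‖ ≤ P.V) → (∀ i, ∀ t ∈ Icc 0 P.T, ∀ y, ‖Torus.partialDeriv i (vb t) y‖ ≤ P.V) →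
    (∀ t ∈ Icc 0 P.T, ∀ y, ‖Torus.timeDerivWithin (Icc 0 P.T) vb t y‖ ≤ P.V) →
    (∀ t ∈ Icc 0 P.T, ∀ y, ‖Rcb t y‖ ≤ ρc) →
    (∀ t ∈ Icc 0 P.T, ∀ y, ‖N t y‖ ≤ P.A) → (∀ t ∈ Icc 0 P.T, ∀ y l, ‖Torus.partialDeriv l (N t) y‖ ≤ P.A * P.ℓ⁻¹) →
    (∀ t ∈ Icc 0 P.T, ∀ y, ‖Torus.timeDerivWithin (Icc 0 P.T) N t y‖ ≤ P.A * P.ℓ⁻¹) →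
    (∀ t ∈ Icc 0 P.T, ∀ y l m, ‖Torus.partialDeriv m (Torus.partialDeriv l (N t)) y‖ ≤ P.A * P.ℓ⁻¹ ^ 2) →
    (∀ t ∈ Icc 0 P.T, ∀ y l, ‖Torus.timeDerivWithin (Icc 0 P.T) (fun s z => Torus.partialDeriv l (N s) z) t y‖ ≤ P.A * P.ℓ⁻¹ ^ 2) →
    (∀ t ∈ Icc 0 P.T, ∫ y, ‖N t y‖ ≤ P.δ) →
    ∃ (v' : ℝ → (UnitAddTorus (Fin 3)) → (EuclideanSpace ℝ (Fin 3))) (p' : ℝ → (UnitAddTorus (Fin 3)) → ℝ) (R' : ℝ → (UnitAddTorus (Fin 3)) → Fin 3 → (EuclideanSpace ℝ (Fin 3))),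
      Torus.IsNSReynoldsOn (Icc 0 P.T) ν v' p' R' ∧ (∀ t ∈ Icc 0 P.T, HasZeroMean (v' t)) ∧
      (∀ t ∈ Icc 0 P.T, eLpNorm (v' t - vb t) 2 volume ≤ ENNReal.ofReal (Real.sqrt (P.Ep c) + Real.sqrt (P.Er c))) ∧
      (∀ t ∈ Icc 0 P.T, ∫ y, ‖R' t y‖ ≤ 2 * ρc + P.stepL1 c + S' * (c.C₁ * (P.Lp c + P.Lc c + 2 * Real.sqrt (P.EX c)))) ∧
      (∀ t ∈ Icc 0 P.T, ∀ y, ‖R' t y‖ ≤ 2 * ρc + P.stepSup c + c.Kℛ * (S' * (P.Sp c + P.Sc c + 2 * P.D.XSup (P.A₀ c) c.B))) ∧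
      (∀ t ∈ Icc 0 P.T, ∀ y, ‖v' t y‖ ≤ P.stepC0 c) ∧
      (∀ t ∈ Icc 0 P.T, ∀ y i, ‖Torus.partialDeriv i (v' t) y‖ ≤ P.stepC1 c) ∧
      (∀ t ∈ Icc 0 P.T, ∀ y, ‖Torus.timeDerivWithin (Icc 0 P.T) v' t y‖ ≤ P.stepCt c + S' * (2 * P.Sw c)) ∧
      (∀ t ∈ Icc 0 P.T, |(e t - ∫ y, ‖v' t y‖ ^ 2) - ((e t - ∫ y, ‖vb t y‖ ^ 2) - pumpProfile δ (Gm t) ^ 2)| ≤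
        errE c P + (18 / radius (Fin 3) + 3) * P.δ) ∧
      (∀ t ∈ Icc 0 P.T, s t = 0 → v' t = vb t ∧ R' t = Rcb t) := by
  obtain ⟨c, hc, hCp, hjet⟩ := jet_step_weighted
  refine ⟨c, hc, hCp, ?_⟩
  intro P ν e vb pb Rcb N s Gm Δ δ ρc S' hP hν hν1 hγΔ hδ hold hmean hRcS hRcsym hRctr hNS hNsym hs hs01 hS' hsflat hs_sq
    hv0 hv1 hvt hρ hNA hN1 hNt hN2 hNt1 hNδ
  obtain ⟨v', p', R', hns', hmean', hL2, hL1, hsup, hC0, hC1, hCt, hE, hQ, hloc⟩ :=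
    hjet P ν vb pb Rcb N s ρc S' hP hν hν1 hNS hNsym hs hs01 hS' hold hmean hRcS hRcsym hv0 hv1 hvt hρ hNA hN1 hNt hN2 hNt1 hNδ
  refine ⟨v', p', R', hns', hmean', hL2, hL1, hsup, hC0, hC1, hCt, fun t ht => ?_, fun t ht h0 => ?_⟩
  · -- the energy bookkeeping
    have hr := radius_pos JetStep.Datum.hd3 (d := Fin 3)
    have h1 := hE t ht
    have h2 := hQ t ht
    have h3 := hNδ t ht
    have e6 : 6 * P.γ₀ / radius (Fin 3) = 2 * Δ := by rw [hγΔ]; field_simp; ring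
    rw [e6] at h2
    set I := ∫ y, (3 * JAmp.rho P.γ₀ N t y - Torus.tensorTrace (N t) y) with hI
    have hs2 : (s t) ^ 2 ≤ 1 := by have := hs01 t ht; nlinarith [this.1, this.2]
    have hs20 : 0 ≤ (s t) ^ 2 := sq_nonneg _
    have h4 : |(s t) ^ 2 * I - pumpProfile δ (Gm t) ^ 2| ≤ (18 / radius (Fin 3) + 3) * P.δ := by
      rw [← hs_sq t, ← mul_sub, abs_mul, abs_of_nonneg hs20]
      have h5 : |I - 2 * Δ| ≤ (18 / radius (Fin 3) + 3) * P.δ := h2.trans (mul_le_mul_of_nonneg_left h3 (by positivity))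
      calc (s t) ^ 2 * |I - 2 * Δ| ≤ 1 * ((18 / radius (Fin 3) + 3) * P.δ) := mul_le_mul hs2 h5 (abs_nonneg _) zero_le_one
        _ = _ := one_mul _
    have e1 : (e t - ∫ y, ‖v' t y‖ ^ 2) - ((e t - ∫ y, ‖vb t y‖ ^ 2) - pumpProfile δ (Gm t) ^ 2) =
        -(((∫ y, ‖v' t y‖ ^ 2) - (∫ y, ‖vb t y‖ ^ 2) - (s t) ^ 2 * I) + ((s t) ^ 2 * I - pumpProfile δ (Gm t) ^ 2)) := by ring
    rw [e1, abs_neg]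
    refine (abs_add_le _ _).trans (add_le_add ?_ h4)
    rw [errE_def]; exact h1
  · obtain ⟨hv, hR⟩ := hloc t ht h0 (hsflat t ht h0)
    refine ⟨hv, ?_⟩
    rw [hR]; exact traceless_eq_self_of_traceFree (hRctr t ht)

end EnergyPump

end Literature.Analysis.FluidPDE
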